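import Mathlib

/-!
# Solo-blind seat (MatrixMultiplication), s72 — the Network Structure Theorem (paper/KraftK3.md §7.12, K3.12.15 (R1))

LINE NETWORKS.  Work in `𝔽₃ⁿ = Fin n → ZMod 3`.  A MULTILINEAR MONOMIAL is `x ↦ ∏_{i ∈ T} x_i` (`T ⊆ Fin n`); an AXIS LINE is
the set of three points agreeing with a base point `p` off one coordinate `j`, and a LINE NETWORK is an `𝔽₃`-linear combination of
indicator functions of axis lines.  In the frame-certificate programme (`SoloBlindFrameCertificate`, `SoloBlindValueRelation`, …) a
point set `A` is GOOD for a frame iff the multilinear evaluation vectors `(∏_{i∈T} y_i)_T`, `y ∈ A`, are linearly independent; a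
dependency is exactly a nonzero weight function `ν` supported in `A` that is ORTHOGONAL TO EVERY MULTILINEAR MONOMIAL
(`Σ_x ν(x) ∏_{i∈T} x_i = 0` for all `T`).

NETWORK STRUCTURE THEOREM (R1).  A weight function `ν : 𝔽₃ⁿ → 𝔽₃` is orthogonal to every multilinear monomial if and only if it is
a line network (`mlOrthogonal_iff_mem_lineNetworks`):
* every axis-line indicator is orthogonal to the multilinear monomials (`axisLine_mlOrthogonal`: along the line the monomial is either
  constant — three equal terms sum to `0` in characteristic `3` — or linear in the moving coordinate — `0 + 1 + 2 = 0`);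
* conversely (`mlOrthogonal_mem_lineNetworks`), by induction on `n`, slicing along the first coordinate: if `ν_t = ν(t, ·)` then
  `ν_0 + ν_1 + ν_2` and `ν_1 − ν_2` are orthogonal to the multilinear monomials of `𝔽₃ⁿ⁻¹`, hence so are `ν_1 − ν_0` and `ν_2 − ν_0`,
  which are line networks by induction; and `ν = (lift of ν_0 along direction 0) + (ν_1 − ν_0 pushed into the slice x_0 = 1)
  + (ν_2 − ν_0 pushed into the slice x_0 = 2)`, each summand a line network.
Consequently every obstruction to goodness of a frame is a nonzero line network supported in the point set
(`dependency_is_lineNetwork`).  Pure linear algebra over `𝔽₃`; no `ω` content.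
-/

set_option linter.dupNamespace false
set_option autoImplicit false

namespace Summit.MatrixMultiplication.MatrixMultiplication.Theorems

open Finset

/-- The multilinear monomial `x ↦ ∏_{i ∈ T} x_i` on `𝔽₃ⁿ`. -/
def mlMonomial {n : ℕ} (T : Finset (Fin n)) (x : Fin n → ZMod 3) : ZMod 3 := ∏ i ∈ T, x i

/-- Indicator function of the AXIS LINE through `p` in coordinate direction `j` (the three points agreeing with `p` off `j`). -/
def axisLine {n : ℕ} (p : Fin n → ZMod 3) (j : Fin n) (x : Fin n → ZMod 3) : ZMod 3 :=
  if (∀ i, i ≠ j → x i = p i) then 1 else 0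

/-- The LINE NETWORKS: the `𝔽₃`-span of all axis-line indicators. -/
def lineNetworks (n : ℕ) : Submodule (ZMod 3) ((Fin n → ZMod 3) → ZMod 3) :=
  Submodule.span (ZMod 3) (Set.range fun pj : (Fin n → ZMod 3) × Fin n => axisLine pj.1 pj.2)

/-- `ν` is orthogonal to every multilinear monomial: `Σ_x ν(x) ∏_{i∈T} x_i = 0` for all `T`. -/
abbrev MLOrthogonal {n : ℕ} (ν : (Fin n → ZMod 3) → ZMod 3) : Prop :=
  ∀ T : Finset (Fin n), ∑ x, ν x * mlMonomial T x = 0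

/-! ## Linearity of orthogonality -/

/-- Orthogonality is preserved by sums. -/
theorem MLOrthogonal.add {n : ℕ} {ν μ : (Fin n → ZMod 3) → ZMod 3} (hν : MLOrthogonal ν) (hμ : MLOrthogonal μ) :
    MLOrthogonal (ν + μ) := by
  intro T
  simp only [Pi.add_apply, add_mul, Finset.sum_add_distrib, hν T, hμ T, add_zero]

/-- Orthogonality is preserved by scalar multiples. -/
theorem MLOrthogonal.smul {n : ℕ} {ν : (Fin n → ZMod 3) → ZMod 3} (c : ZMod 3) (hν : MLOrthogonal ν) :
    MLOrthogonal (c • ν) := by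
  intro T
  simp only [Pi.smul_apply, smul_eq_mul, mul_assoc, ← Finset.mul_sum, hν T, mul_zero]

/-! ## Axis lines are orthogonal to the multilinear monomials -/

/-- A sum over `ZMod 3` is the sum of the three values. -/
theorem sum_univ_zmod3 {M : Type*} [AddCommMonoid M] (g : ZMod 3 → M) : ∑ t, g t = g 0 + g 1 + g 2 :=
  Fin.sum_univ_three g

/-- The points of the axis line through `p` in direction `j` are exactly the updates `p[j ↦ t]`. -/
theorem axisLine_filter_eq_image {n : ℕ} (p : Fin n → ZMod 3) (j : Fin n) :
    (Finset.univ.filter fun x : Fin n → ZMod 3 => ∀ i, i ≠ j → x i = p i)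
      = Finset.univ.image (fun t : ZMod 3 => Function.update p j t) := by
  ext x
  simp only [Finset.mem_filter, Finset.mem_univ, true_and, Finset.mem_image]
  constructor
  · intro hx
    refine ⟨x j, ?_⟩
    funext i
    by_cases hij : i = j
    · subst hij; simp
    · rw [Function.update_apply, if_neg hij]; exact (hx i hij).symm
  · rintro ⟨t, rfl⟩ i hij
    rw [Function.update_apply, if_neg hij]

/-- A sum weighted by an axis-line indicator is the sum over the three points of the line. -/
theorem sum_axisLine_mul {n : ℕ} (p : Fin n → ZMod 3) (j : Fin n) (f : (Fin n → ZMod 3) → ZMod 3) :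
    ∑ x, axisLine p j x * f x = ∑ t : ZMod 3, f (Function.update p j t) := by
  unfold axisLine
  simp only [ite_mul, one_mul, zero_mul]
  rw [← Finset.sum_filter, axisLine_filter_eq_image, Finset.sum_image]
  intro t₁ _ t₂ _ h
  have := congr_fun h j
  simpa [Function.update_apply] using this

/-- (R1, easy direction) Every axis-line indicator is orthogonal to every multilinear monomial. -/
theorem axisLine_mlOrthogonal {n : ℕ} (p : Fin n → ZMod 3) (j : Fin n) : MLOrthogonal (axisLine p j) := by
  intro T
  rw [sum_axisLine_mul]
  unfold mlMonomial
  by_cases hj : j ∈ T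
  · -- the monomial is linear in the moving coordinate: `Σ_t t · c = (0 + 1 + 2) · c = 0`
    have key : ∀ t : ZMod 3, ∏ i ∈ T, Function.update p j t i = t * ∏ i ∈ T.erase j, p i := by
      intro t
      rw [← Finset.mul_prod_erase T _ hj, Function.update_apply, if_pos rfl]
      congr 1
      apply Finset.prod_congr rfl
      intro i hi
      rw [Function.update_apply, if_neg (Finset.ne_of_mem_erase hi)]
    simp only [key, ← Finset.sum_mul]
    have h3 : ∑ t : ZMod 3, t = 0 := by rw [sum_univ_zmod3]; decide
    rw [h3, zero_mul]
  · -- the monomial is constant along the line: three equal terms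
    have key : ∀ t : ZMod 3, ∏ i ∈ T, Function.update p j t i = ∏ i ∈ T, p i := by
      intro t
      apply Finset.prod_congr rfl
      intro i hi
      rw [Function.update_apply, if_neg (ne_of_mem_of_not_mem hi hj)]
    simp only [key]
    rw [sum_univ_zmod3]
    have h3 : ∀ c : ZMod 3, c + c + c = 0 := by decide
    exact h3 _

/-- Hence every line network is orthogonal to every multilinear monomial. -/
theorem mlOrthogonal_of_mem_lineNetworks {n : ℕ} {ν : (Fin n → ZMod 3) → ZMod 3} (hν : ν ∈ lineNetworks n) :
    MLOrthogonal ν := by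
  unfold lineNetworks at hν
  refine Submodule.span_induction (p := fun μ _ => MLOrthogonal μ) ?_ ?_ ?_ ?_ hν
  · rintro _ ⟨⟨p, j⟩, rfl⟩
    exact axisLine_mlOrthogonal p j
  · intro T; simp
  · intro a b _ _ ha hb
    exact ha.add hb
  · intro c a _ ha
    exact ha.smul c

/-! ## Slicing along the first coordinate -/

/-- Split a sum over `𝔽₃ⁿ⁺¹` according to the first coordinate. -/
theorem sum_cons_split {n : ℕ} (f : (Fin (n + 1) → ZMod 3) → ZMod 3) :
    ∑ x, f x = ∑ t : ZMod 3, ∑ x' : Fin n → ZMod 3, f (Fin.cons t x') := by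
  rw [← (Fin.consEquiv fun _ : Fin (n + 1) => ZMod 3).sum_comp, Fintype.sum_prod_type]
  rfl

/-- A monomial avoiding the first coordinate does not see it. -/
theorem mlMonomial_map_succ {n : ℕ} (T : Finset (Fin n)) (t : ZMod 3) (x' : Fin n → ZMod 3) :
    mlMonomial (T.map (Fin.succEmb n)) (Fin.cons t x') = mlMonomial T x' := by
  unfold mlMonomial
  rw [Finset.prod_map]
  simp only [Fin.coe_succEmb, Fin.cons_succ]

/-- A monomial containing the first coordinate is `x_0` times a monomial of the remaining coordinates. -/
theorem mlMonomial_insert_zero {n : ℕ} (T : Finset (Fin n)) (t : ZMod 3) (x' : Fin n → ZMod 3) :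
    mlMonomial (insert 0 (T.map (Fin.succEmb n))) (Fin.cons t x') = t * mlMonomial T x' := by
  have h0 : (0 : Fin (n + 1)) ∉ T.map (Fin.succEmb n) := by
    intro h
    obtain ⟨a, _, ha⟩ := Finset.mem_map.mp h
    exact Fin.succ_ne_zero a ha
  rw [← mlMonomial_map_succ T t x']
  unfold mlMonomial
  rw [Finset.prod_insert h0, Fin.cons_zero]

/-- Push a weight function on `𝔽₃ⁿ` into the slice `{x_0 = c}` of `𝔽₃ⁿ⁺¹` (zero elsewhere); a linear map. -/
def slicePush (n : ℕ) (c : ZMod 3) : ((Fin n → ZMod 3) → ZMod 3) →ₗ[ZMod 3] ((Fin (n + 1) → ZMod 3) → ZMod 3) where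
  toFun g := fun x => if x 0 = c then g (Fin.tail x) else 0
  map_add' g h := by
    funext x
    simp only [Pi.add_apply]
    split_ifs <;> simp
  map_smul' a g := by
    funext x
    simp only [Pi.smul_apply, smul_eq_mul, RingHom.id_apply]
    split_ifs <;> simp

/-- Pointwise formula for `slicePush`. -/
theorem slicePush_apply {n : ℕ} (c : ZMod 3) (g : (Fin n → ZMod 3) → ZMod 3) (x : Fin (n + 1) → ZMod 3) :
    slicePush n c g x = if x 0 = c then g (Fin.tail x) else 0 := rfl

/-- Pushing an axis line of `𝔽₃ⁿ` into a slice gives an axis line of `𝔽₃ⁿ⁺¹`. -/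
theorem slicePush_axisLine {n : ℕ} (c : ZMod 3) (p : Fin n → ZMod 3) (j : Fin n) :
    slicePush n c (axisLine p j) = axisLine (Fin.cons c p) j.succ := by
  funext x
  have key : (x 0 = c ∧ ∀ i, i ≠ j → Fin.tail x i = p i) ↔ (∀ i : Fin (n + 1), i ≠ j.succ → x i = (Fin.cons c p : Fin (n + 1) → ZMod 3) i) := by
    constructor
    · rintro ⟨h0, h1⟩ i hi
      induction i using Fin.cases with
      | zero => simpa using h0
      | succ i =>
        have hij : i ≠ j := fun h => hi (by rw [h])
        simpa [Fin.tail] using h1 i hij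
    · intro h
      refine ⟨?_, fun i hi => ?_⟩
      · simpa using h 0 (Fin.succ_ne_zero j).symm
      · have := h i.succ (fun e => hi (Fin.succ_inj.mp e))
        simpa [Fin.tail] using this
  rw [slicePush_apply]
  unfold axisLine
  by_cases h0 : x 0 = c
  · by_cases h1 : ∀ i, i ≠ j → Fin.tail x i = p i
    · rw [if_pos h0, if_pos h1, if_pos (key.mp ⟨h0, h1⟩)]
    · rw [if_pos h0, if_neg h1, if_neg (fun h => h1 (key.mpr h).2)]
  · rw [if_neg h0, if_neg (fun h => h0 (key.mpr h).1)]

/-- `slicePush` maps line networks to line networks. -/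
theorem slicePush_mem_lineNetworks {n : ℕ} (c : ZMod 3) {g : (Fin n → ZMod 3) → ZMod 3} (hg : g ∈ lineNetworks n) :
    slicePush n c g ∈ lineNetworks (n + 1) := by
  have hle : lineNetworks n ≤ (lineNetworks (n + 1)).comap (slicePush n c) := by
    unfold lineNetworks
    rw [Submodule.span_le]
    rintro _ ⟨⟨p, j⟩, rfl⟩
    simp only [SetLike.mem_coe, Submodule.mem_comap, slicePush_axisLine]
    exact Submodule.subset_span ⟨(Fin.cons c p, j.succ), rfl⟩
  exact hle hg

/-- The axis line in direction `0` through `(0, x')` is the fibre `{x : tail x = x'}`. -/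
theorem axisLine_cons_zero_apply {n : ℕ} (x' : Fin n → ZMod 3) (x : Fin (n + 1) → ZMod 3) :
    axisLine (Fin.cons 0 x') 0 x = if Fin.tail x = x' then 1 else 0 := by
  unfold axisLine
  have key : (∀ i : Fin (n + 1), i ≠ 0 → x i = (Fin.cons 0 x' : Fin (n + 1) → ZMod 3) i) ↔ Fin.tail x = x' := by
    constructor
    · intro h
      funext i
      simpa [Fin.tail] using h i.succ (Fin.succ_ne_zero i)
    · intro h i hi
      induction i using Fin.cases with
      | zero => exact absurd rfl hi
      | succ i =>
        rw [Fin.cons_succ, ← h]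
        rfl
  by_cases h : Fin.tail x = x'
  · rw [if_pos h, if_pos (key.mpr h)]
  · rw [if_neg h, if_neg (fun h' => h (key.mp h'))]

/-- Lifting a weight function along direction `0` (constant on the fibres) gives a line network: it is the combination
`Σ_{x'} g(x') · 𝟙[line through (0,x') in direction 0]`. -/
theorem lift_mem_lineNetworks {n : ℕ} (g : (Fin n → ZMod 3) → ZMod 3) :
    (fun x : Fin (n + 1) → ZMod 3 => g (Fin.tail x)) ∈ lineNetworks (n + 1) := by
  have h : (fun x : Fin (n + 1) → ZMod 3 => g (Fin.tail x)) = ∑ x', g x' • axisLine (Fin.cons 0 x') 0 := by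
    funext x
    simp only [Finset.sum_apply, Pi.smul_apply, smul_eq_mul, axisLine_cons_zero_apply, mul_ite, mul_one, mul_zero]
    rw [Finset.sum_ite_eq]
    simp
  rw [h]
  exact Submodule.sum_mem _ fun x' _ => Submodule.smul_mem _ _ (Submodule.subset_span ⟨(Fin.cons 0 x', 0), rfl⟩)

/-- The three values of `ZMod 3`. -/
theorem zmod3_cases (t : ZMod 3) : t = 0 ∨ t = 1 ∨ t = 2 := by
  revert t; decide

/-! ## The Network Structure Theorem -/

/-- (R1, main direction) NETWORK STRUCTURE THEOREM: a weight function on `𝔽₃ⁿ` orthogonal to every multilinear monomial is a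
line network (an `𝔽₃`-combination of axis-line indicators). -/
theorem mlOrthogonal_mem_lineNetworks (n : ℕ) :
    ∀ ν : (Fin n → ZMod 3) → ZMod 3, MLOrthogonal ν → ν ∈ lineNetworks n := by
  induction n with
  | zero =>
    intro ν hν
    have h := hν ∅
    have hν0 : ν = 0 := by
      funext x
      have hx : ∀ y : Fin 0 → ZMod 3, y = x := fun y => funext fun i => Fin.elim0 i
      simp only [mlMonomial, Finset.prod_empty, mul_one] at h
      rw [Fintype.sum_eq_single x (fun y hy => absurd (hx y) hy)] at h
      exact h
    rw [hν0]
    exact Submodule.zero_mem _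
  | succ n ih =>
    intro ν hν
    -- (i) the sum of the three slices is orthogonal to the multilinear monomials of `𝔽₃ⁿ`
    have hsum : MLOrthogonal ((fun x' => ν (Fin.cons 0 x')) + (fun x' => ν (Fin.cons 1 x')) + fun x' => ν (Fin.cons 2 x')) := by
      intro T
      have h := hν (T.map (Fin.succEmb n))
      rw [sum_cons_split] at h
      simp only [mlMonomial_map_succ] at h
      rw [sum_univ_zmod3] at h
      simpa [Pi.add_apply, add_mul, Finset.sum_add_distrib] using h
    -- (ii) the slice-weighted sum `0·ν_0 + 1·ν_1 + 2·ν_2` is orthogonal as well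
    have hwt : MLOrthogonal ((fun x' => ν (Fin.cons 1 x')) + (2 : ZMod 3) • fun x' => ν (Fin.cons 2 x')) := by
      intro T
      have h := hν (insert 0 (T.map (Fin.succEmb n)))
      rw [sum_cons_split] at h
      simp only [mlMonomial_insert_zero] at h
      rw [sum_univ_zmod3] at h
      simp only [zero_mul, mul_zero, Finset.sum_const_zero, zero_add, one_mul] at h
      have e : ∀ x', ((fun x' => ν (Fin.cons 1 x')) + (2 : ZMod 3) • fun x' => ν (Fin.cons 2 x')) x' * mlMonomial T x'
          = ν (Fin.cons 1 x') * mlMonomial T x' + ν (Fin.cons 2 x') * (2 * mlMonomial T x') := by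
        intro x'
        simp only [Pi.add_apply, Pi.smul_apply, smul_eq_mul]
        ring
      rw [Finset.sum_congr rfl (fun x' _ => e x'), Finset.sum_add_distrib]
      exact h
    -- (iii) hence `ν_1 - ν_0` and `ν_2 - ν_0` are orthogonal, so line networks by induction
    have idα : ∀ a b c : ZMod 3, b - a = 2 * (a + b + c) + 2 * (b + 2 * c) := by decide
    have idβ : ∀ a b c : ZMod 3, c - a = 2 * (a + b + c) + (b + 2 * c) := by decide
    have hα : MLOrthogonal ((fun x' => ν (Fin.cons 1 x')) - fun x' => ν (Fin.cons 0 x')) := by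
      have e : ((fun x' => ν (Fin.cons 1 x')) - fun x' => ν (Fin.cons 0 x'))
          = (2 : ZMod 3) • ((fun x' => ν (Fin.cons 0 x')) + (fun x' => ν (Fin.cons 1 x')) + fun x' => ν (Fin.cons 2 x'))
            + (2 : ZMod 3) • ((fun x' => ν (Fin.cons 1 x')) + (2 : ZMod 3) • fun x' => ν (Fin.cons 2 x')) := by
        funext x'
        simp only [Pi.sub_apply, Pi.add_apply, Pi.smul_apply, smul_eq_mul]
        exact idα _ _ _
      rw [e]
      exact (hsum.smul 2).add (hwt.smul 2)
    have hβ : MLOrthogonal ((fun x' => ν (Fin.cons 2 x')) - fun x' => ν (Fin.cons 0 x')) := by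
      have e : ((fun x' => ν (Fin.cons 2 x')) - fun x' => ν (Fin.cons 0 x'))
          = (2 : ZMod 3) • ((fun x' => ν (Fin.cons 0 x')) + (fun x' => ν (Fin.cons 1 x')) + fun x' => ν (Fin.cons 2 x'))
            + ((fun x' => ν (Fin.cons 1 x')) + (2 : ZMod 3) • fun x' => ν (Fin.cons 2 x')) := by
        funext x'
        simp only [Pi.sub_apply, Pi.add_apply, Pi.smul_apply, smul_eq_mul]
        exact idβ _ _ _
      rw [e]
      exact (hsum.smul 2).add hwt
    have hαN := ih _ hα
    have hβN := ih _ hβ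
    -- (iv) reassemble `ν` from the lift of `ν_0` and the two pushed differences
    have decomp : ν = (fun x => ν (Fin.cons 0 (Fin.tail x)))
        + slicePush n 1 ((fun x' => ν (Fin.cons 1 x')) - fun x' => ν (Fin.cons 0 x'))
        + slicePush n 2 ((fun x' => ν (Fin.cons 2 x')) - fun x' => ν (Fin.cons 0 x')) := by
      funext x
      refine Fin.consCases (fun t x' => ?_) x
      simp only [Pi.add_apply, slicePush_apply, Fin.cons_zero, Fin.tail_cons, Pi.sub_apply]
      rcases zmod3_cases t with rfl | rfl | rfl
      · rw [if_neg (show ¬ ((0 : ZMod 3) = 1) by decide), if_neg (show ¬ ((0 : ZMod 3) = 2) by decide)]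
        ring
      · rw [if_pos rfl, if_neg (show ¬ ((1 : ZMod 3) = 2) by decide)]
        ring
      · rw [if_neg (show ¬ ((2 : ZMod 3) = 1) by decide), if_pos rfl]
        ring
    rw [decomp]
    exact Submodule.add_mem _
      (Submodule.add_mem _ (lift_mem_lineNetworks fun x' => ν (Fin.cons 0 x')) (slicePush_mem_lineNetworks 1 hαN))
      (slicePush_mem_lineNetworks 2 hβN)

/-- NETWORK STRUCTURE THEOREM (K3.12.15 (R1)): orthogonality to all multilinear monomials is equivalent to being a line network. -/
theorem mlOrthogonal_iff_mem_lineNetworks {n : ℕ} (ν : (Fin n → ZMod 3) → ZMod 3) :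
    MLOrthogonal ν ↔ ν ∈ lineNetworks n :=
  ⟨mlOrthogonal_mem_lineNetworks n ν, mlOrthogonal_of_mem_lineNetworks⟩

/-! ## Obstructions to goodness are line networks -/

/-- FRAME-CERTIFICATE READING: if the multilinear evaluation vectors `T ↦ ∏_{i∈T} y_i` of the points of `A ⊆ 𝔽₃ⁿ` admit a
nontrivial linear relation with coefficients `ν` (a weight function vanishing outside `A`, not identically zero), then `ν` is a
nonzero LINE NETWORK supported in `A`.  So every obstruction to goodness of a frame is an axis-line network inside the point set. -/
theorem dependency_is_lineNetwork {n : ℕ} (A : Finset (Fin n → ZMod 3)) (ν : (Fin n → ZMod 3) → ZMod 3)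
    (hsupp : ∀ x, x ∉ A → ν x = 0) (hrel : ∀ T : Finset (Fin n), ∑ x ∈ A, ν x * mlMonomial T x = 0) :
    ν ∈ lineNetworks n := by
  refine mlOrthogonal_mem_lineNetworks n ν fun T => ?_
  rw [← Finset.sum_subset (Finset.subset_univ A) (fun x _ hx => by rw [hsupp x hx, zero_mul])]
  exact hrel T

/-- Conversely, a line network supported in `A` is a linear relation among the multilinear evaluation vectors of `A`. -/
theorem lineNetwork_is_dependency {n : ℕ} (A : Finset (Fin n → ZMod 3)) (ν : (Fin n → ZMod 3) → ZMod 3)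
    (hsupp : ∀ x, x ∉ A → ν x = 0) (hν : ν ∈ lineNetworks n) (T : Finset (Fin n)) :
    ∑ x ∈ A, ν x * mlMonomial T x = 0 := by
  rw [Finset.sum_subset (Finset.subset_univ A) (fun x _ hx => by rw [hsupp x hx, zero_mul])]
  exact mlOrthogonal_of_mem_lineNetworks hν T

end Summit.MatrixMultiplication.MatrixMultiplication.Theorems
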